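import Summits.BirchSwinnertonDyer.BirchSwinnertonDyer.Theorems.EdixhovenFibreFiveSevenStarredOptimalManinUnitFiveSevenTransportedHodgePairHneOmega
import Literature.NumberTheory.PAdicHodge.BmaxPlusTransportedReciprocityFormalPoint
import HarnessLib

/-!
# Kato's explicit reciprocity law at the deep formal points of a RAMIFIED good supersingular model `W_D ≡ E₀ (mod ϖ)` over `K_v`,
# from the cells' data and (N1′) ALONE — the Hodge line and `hne` discharged

Cell `pub/bsd-wall`, D-0145 line `route-BirchSwinnertonDyer-EdixhovenFibreFiveSeven`, seat `bsd-line-edix-p4` (gen 27); crux K★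
`stmt-BirchSwinnertonDyer-22226` (`StarredOptimalManinUnitFiveSeven`), line `kato_lever`, memos `Cruxes/StarredOptimalManinUnitFiveSeven/Lines/
kato-lever-K2-transported-period-hom.md` (T5) and `…/kato-lever-K2-hne-direct-omega.md` (F3e). THEOREMS ONLY (no definition, no named fact, no
instance, no `sorry`); helper `--supports stmt-BirchSwinnertonDyer-22226`. **BSD is not proved by this file, and neither is K★**: what it proves is
Kato's formula `⟨[η], P⟩ = −Tr_{F/ℚ_p}(c_P · exp*_d(η) · c)` for ONE ramified good supersingular `𝒪_D`-model at the completion `F = K_v`, at its deep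
formal points, GIVEN the cell data (Weil tower, `ψ = log χ`, de Rham binders) — it is the (K₂)^ram brick of [REC-tower] at the K★ cells, not [REC-tower].

THE ASSEMBLY (`exists_const_tatePairingPoint_eq_neg_trace_of_omegaPeriod_ne_zero`). Inputs: `E = curveFO F (W_D ⊗_ψ 𝒪_F)` good supersingular
(`Δ ∈ 𝒪_F^×`, Hasse `0`), `W_D ≡ E₀ (mod ϖ)` with `E₀/ℤ` good supersingular at `p ≥ 5`, an index `N ≥ e` (the transported period maps
`(LT, P⁰, Q⁰)` of `BmaxPlusTransportedPeriodHomsBdR.exists_transported_periodHoms` are constructed INSIDE), and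
**(N1′): `∫_τ ω_{W_D} ≠ 0` for some `τ ∈ T_pŴ_D`** (tree: `AinfRamTop.omegaPeriod_model_five_ne_zero` / `…seven…` / `…_of_varpi_shape` for the cells).
Chain: `TransportedHodgePairHneOmega.exists_hodgePair_fil_and_hne` (LEAD g28: Hodge-line scalars `(A, B) = (Σaᵢϖⁱ, Σbᵢϖⁱ)` with their analytic
bound AND `ι(p^cA)P⁰τ + ι(p^cB)Q⁰τ = p^{N+c}·∫_τω`, hence `≠ 0` at the (N1′)-witness — so `hne` holds in BOTH branches and `(A, B) ≠ 0`)
⟹ `Literature…BmaxPlusTransportedReciprocityFormalPoint.exists_const_tatePairingPoint_eq_neg_trace_transported_formalPoint` (this seat: canonical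
matching, `T`-adic Kummer cocycle, CM-fibre transport of the Kummer tower, transported integrating pair, `θ`-value, the branch, and (K₂) PROVED, on top of
the socket capstone `BmaxPlusTransportedReciprocity`).

What a K★ cell must still supply: its instances (`W_D = ⟨0,0,0,a·ϖ^{r₄},b·ϖ^{r₆}⟩`, `E₀ = ⟨0,0,0,a[r₄=0],b[r₆=0]⟩`, `p ∈ {5,7}`,
`AinfRamifiedDivisionTransport.map_explicitModel_eq_map_cmFibre`), (N1′) (tree), the Weil tower / `ψ` / de Rham binders of the socket, the chart
`p^N·Σ'[Xʲ]log_{W_D}·z(P)ʲ = p^N·log_ω(P)` (`FormalLogValuesIntegralCoeffChart`), the index step to all of `E(F)` (`ReciprocityFormulaOffLevel`),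
and the descent `K_v → ℚ_p` (`ReciprocityLawDescent`); K★ needs in addition P1-bar (print). None of that is done here.

References: [cite: Kato1993LNM1553, Ch. II Thm. 1.4.1 (3)–(4), Lemma 1.4.3] · [cite: BlochKato1990, Ex. 3.10.1, Example 3.11] ·
[cite: Colmez1992PeriodesAbeliennes, §2] · [cite: Katz1981CrystallineDieudonne, Thm. 5.1.4–5.1.5] · [cite: SilvermanAEC2009, Prop. VII.2.2, VIII §2].
-/

set_option autoImplicit false
-- single-conjunct summit: `Summit.BirchSwinnertonDyer.BirchSwinnertonDyer.…` repeats the name by design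
set_option linter.dupNamespace false

noncomputable section

open Field Function ValuativeRel WittVector NumberField IsDedekindDomain
open scoped NumberField Topology Classical
open Literature.NumberTheory.PAdicHodge Literature.NumberTheory.GaloisRepresentations
  Literature.NumberTheory.GaloisRepresentations.IsNonarchimedeanLocalField Literature.NumberTheory.GaloisRepresentations.LubinTate
  Literature.NumberTheory.GaloisCohomology Literature.NumberTheory.EllipticCurves Literature.NumberTheory.EllipticCurves.FormalGroupChart
  Literature.NumberTheory.PAdicHodge.GaloisContinuity Literature.IUT.LogVolume Literature.RingTheory.FormalGroups
  Literature.AlgebraicGeometry.Resolution _root_.WeierstrassCurve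

namespace Summit.BirchSwinnertonDyer.BirchSwinnertonDyer.Theorems.TransportedReciprocity

variable {K : Type} [Field K] [NumberField K] {p : ℕ} [hprime : Fact p.Prime] (v : HeightOneSpectrum (𝓞 K))
  [CharZero (v.adicCompletion K)] [LocallyCompactSpace (absoluteGaloisGroup (v.adicCompletion K))]
  [Fact (¬ IsUnit (p : integerC (v.adicCompletion K)))]
  [IsAdicComplete (Ideal.span {(p : integerC (v.adicCompletion K))}) (integerC (v.adicCompletion K))]
  [CharP 𝓀[v.adicCompletion K] p] [CharZero (CompletedAlgClosure (v.adicCompletion K))]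
  (hpv : valuation (v.adicCompletion K) (p : v.adicCompletion K) < 1)
  (Dv : EisensteinRoot (v.adicCompletion K) p hpv) (Wm : WeierstrassCurve (EisensteinRoot.CoeffDisc Dv))
  (ψm : EisensteinRoot.CoeffDisc Dv →+* LTCoeff (v.adicCompletion K))
  (hψm : ∀ c, algebraMap (LTCoeff (v.adicCompletion K)) (v.adicCompletion K) (ψm c) = EisensteinRoot.CoeffDisc.toF Dv c)
  (hp2 : p ≠ 2) (hΔ : IsUnit (Wm.map ψm).Δ) (hA : ((Wm.map ψm).map (AinfTop.redCoeff (v.adicCompletion K))).hasseCoeff p = 0)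
  [(AinfTop.curveFO (v.adicCompletion K) (Wm.map ψm)).IsElliptic]
  [(curveOver (CompletedAlgClosure (v.adicCompletion K)) (Wm.map ψm)).IsElliptic]
  (e : (k : ℕ) → geomTorsion (AinfTop.curveFO (v.adicCompletion K) (Wm.map ψm)) ((p ^ k : ℕ) : ℤ) →
    geomTorsion (AinfTop.curveFO (v.adicCompletion K) (Wm.map ψm)) ((p ^ k : ℕ) : ℤ) → AlgebraicClosure (v.adicCompletion K))
  (hμ : ∀ k S T, e k S T ^ (p ^ k) = 1) (hadd₁ : ∀ k S₁ S₂ T, e k (S₁ + S₂) T = e k S₁ T * e k S₂ T)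
  (hadd₂ : ∀ k S T₁ T₂, e k S (T₁ + T₂) = e k S T₁ * e k S T₂)
  (hgal : ∀ k (σ : absoluteGaloisGroup (v.adicCompletion K))
    (S T : geomTorsion (AinfTop.curveFO (v.adicCompletion K) (Wm.map ψm)) ((p ^ k : ℕ) : ℤ)), σ • e k S T = e k (σ • S) (σ • T))
  (hcompat : ∀ k (S T : geomTorsion (AinfTop.curveFO (v.adicCompletion K) (Wm.map ψm)) ((p ^ (k + 1) : ℕ) : ℤ)),
    e k (torsionMulHom (AinfTop.curveFO (v.adicCompletion K) (Wm.map ψm)) (p ^ (k + 1)) (p ^ k) p (pow_succ p k).symm S)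
      (torsionMulHom (AinfTop.curveFO (v.adicCompletion K) (Wm.map ψm)) (p ^ (k + 1)) (p ^ k) p (pow_succ p k).symm T) =
        e (k + 1) S T ^ p)

set_option maxHeartbeats 3200000 in
include hgal hp2 hΔ hA hψm in
/-- ★★★★ **Kato's explicit reciprocity law at the deep formal points of a ramified good supersingular model, from the cells' data and (N1′) alone.**
`F = K_v`; `E = curveFO F (W_D ⊗_ψ 𝒪_F)` good supersingular, `W_D ≡ E₀ (mod ϖ)`, `E₀/ℤ` good supersingular at `p ≥ 5`; an index `N ≥ e`;
(N1′) `∫_τ ω_{W_D} ≠ 0` for some `τ`; the cell data of the socket (the transported period maps are constructed inside, `exists_transported_periodHoms`). Then there is ONE `c ∈ F` such that for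
every `η ∈ Z¹(Γ_F, T_pE)`, every `P ∈ E(F)` with a `p`-power division sequence `Q` (`Q₀ = P`) whose base is a formal point with `‖z(P)‖^N ≤ ‖p‖`, and every
`c_P ∈ F` with `ι(c_P) = p^N·Σ'[Xʲ]log_{W_D}·z(P)ʲ`: **`⟨[η], P⟩ = −Tr_{F/ℚ_p}(c_P · exp*_d(η) · c)`** — NO Hodge-line, `hne`, (K₂), matching, cocycle or
integrating-pair or period-map hypothesis. [cite: Kato1993LNM1553, Ch. II Thm. 1.4.1 (3)–(4), Lemma 1.4.3] [cite: BlochKato1990, Ex. 3.10.1, Example 3.11]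
[cite: Colmez1992PeriodesAbeliennes, §2] [cite: Katz1981CrystallineDieudonne, Thm. 5.1.4–5.1.5] -/
theorem exists_const_tatePairingPoint_eq_neg_trace_of_omegaPeriod_ne_zero (hp5 : 5 ≤ p)
    (E₀ : WeierstrassCurve ℤ)
    (hWE : Wm.map (Ideal.Quotient.mk (Ideal.span {EisensteinRoot.CoeffDisc.of Dv (AdjoinRoot.root Dv.poly)})) =
      (E₀.map (algebraMap ℤ (EisensteinRoot.CoeffDisc Dv))).map
        (Ideal.Quotient.mk (Ideal.span {EisensteinRoot.CoeffDisc.of Dv (AdjoinRoot.root Dv.poly)})))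
    (hΔ₀ : ¬ (p : ℤ) ∣ E₀.Δ) (hA₀ : (E₀.map (Int.castRingHom (ZMod p))).hasseCoeff p = 0)
    [(E₀.map (Int.castRingHom ℚ_[p])).IsElliptic] [(E₀.map (Int.castRingHom (ZMod p))).IsElliptic]
    [(curveOver (CompletedAlgClosure (v.adicCompletion K)) E₀).IsElliptic]
    {N : ℕ} (hN : Dv.e ≤ N)
    (hN1' : ∃ τ : AinfTop.TatePtO (v.adicCompletion K) (Wm.map ψm) p,
      AinfRamTop.omegaPeriod Wm (surjective_fontaineTheta_integerC hpv) (AinfTop.seqO (Wm.map ψm) τ) (AinfTop.seqO_zero (Wm.map ψm) τ)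
        (AinfRamTop.mulPC_seqO Wm ψm hψm τ) ≠ 0)
    (ψ : C(absoluteGaloisGroup (v.adicCompletion K), ℤ_[p])) (hψ : ∀ σ τ, ψ (σ * τ) = ψ σ + ψ τ)
    (hψlog : ∀ τ, (ψ τ : ℚ_[p]) = logCyclotomic (F := (v.adicCompletion K)) p τ)
    (heL : ∀ (c : ℤ_[p]) (S U : (AinfTop.curveFO (v.adicCompletion K) (Wm.map ψm)).tateModule p),
      (weilContPairingPadic (AinfTop.curveFO (v.adicCompletion K) (Wm.map ψm)) (v.adicCompletion K) p e hμ hadd₁ hadd₂ hgal hcompat).toLin (c • S) U =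
      twistHom (v.adicCompletion K) p ((weilContPairingPadic (AinfTop.curveFO (v.adicCompletion K) (Wm.map ψm)) (v.adicCompletion K) p e hμ hadd₁ hadd₂ hgal hcompat).toLin S U) c)
    (healt : ∀ S : (AinfTop.curveFO (v.adicCompletion K) (Wm.map ψm)).tateModule p,
      (weilContPairingPadic (AinfTop.curveFO (v.adicCompletion K) (Wm.map ψm)) (v.adicCompletion K) p e hμ hadd₁ hadd₂ hgal hcompat).toLin S S = 0)
    (henondeg : ∀ S : (AinfTop.curveFO (v.adicCompletion K) (Wm.map ψm)).tateModule p,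
      (∀ U, (weilContPairingPadic (AinfTop.curveFO (v.adicCompletion K) (Wm.map ψm)) (v.adicCompletion K) p e hμ hadd₁ hadd₂ hgal hcompat).toLin S U = 0) → S = 0)
    (hinj : letI := LocalField.padicAlgebra (v.adicCompletion K) p hpv
      (bdRPeriodRingData (F := (v.adicCompletion K)) (p := p) hpv).CupLogInjective (logCyclotomic p)
        (restrictedRationalTateRep (AinfTop.curveFO (v.adicCompletion K) (Wm.map ψm)) (v.adicCompletion K) p))
    (hde : letI := LocalField.padicAlgebra (v.adicCompletion K) p hpv
      ∀ η : contOneCocycles (restrictedTateRep (AinfTop.curveFO (v.adicCompletion K) (Wm.map ψm)) (v.adicCompletion K) p).toTopRep,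
        (bdRPeriodRingData (F := (v.adicCompletion K)) (p := p) hpv).HasDualExp (logCyclotomic p)
          (restrictedRationalTateRep (AinfTop.curveFO (v.adicCompletion K) (Wm.map ψm)) (v.adicCompletion K) p)
          fun σ => TateModule.toRational p (η.1 σ))
    (d : letI := LocalField.padicAlgebra (v.adicCompletion K) p hpv
      (bdRPeriodRingData (F := (v.adicCompletion K)) (p := p) hpv).FilZeroLine
        (restrictedRationalTateRep (AinfTop.curveFO (v.adicCompletion K) (Wm.map ψm)) (v.adicCompletion K) p)) :
    letI := LocalField.padicAlgebra (v.adicCompletion K) p hpv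
    ∃ c : v.adicCompletion K,
      ∀ (η : contOneCocycles (restrictedTateRep (AinfTop.curveFO (v.adicCompletion K) (Wm.map ψm)) (v.adicCompletion K) p).toTopRep)
        (P : ((AinfTop.curveFO (v.adicCompletion K) (Wm.map ψm)).baseChange (v.adicCompletion K)).toAffine.Point)
        (Q : ℕ → geomPoints ((AinfTop.curveFO (v.adicCompletion K) (Wm.map ψm)).baseChange (v.adicCompletion K)))
        (hQ : ∀ n, p • Q (n + 1) = Q n)
        (_hQ0 : Q 0 = toGeomPoints ((AinfTop.curveFO (v.adicCompletion K) (Wm.map ψm)).baseChange (v.adicCompletion K)) P)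
        (hP1 : AinfTop.geomToCO (Wm.map ψm) (Q 0) ∈ kernel (NormedField.valuation (K := CompletedAlgClosure (v.adicCompletion K)))
          (curveOver (CompletedAlgClosure (v.adicCompletion K)) (Wm.map ψm))),
        ‖((zPt (AinfTop.geomToCO (Wm.map ψm) (Q 0)) hP1 : CBall (v.adicCompletion K)) : CompletedAlgClosure (v.adicCompletion K))‖ ^ N ≤
            ‖(p : CompletedAlgClosure (v.adicCompletion K))‖ →
        ∀ cP : v.adicCompletion K,
          algebraMap (v.adicCompletion K) (CompletedAlgClosure (v.adicCompletion K)) cP =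
            (p : CompletedAlgClosure (v.adicCompletion K)) ^ N *
              ∑' j : ℕ, PowerSeries.coeff j (Wm.map ((CBall (v.adicCompletion K)).subtype.comp (EisensteinRoot.CoeffDisc.toCBall Dv))).formalLog *
                ((zPt (AinfTop.geomToCO (Wm.map ψm) (Q 0)) hP1 : CBall (v.adicCompletion K)) : CompletedAlgClosure (v.adicCompletion K)) ^ j →
          ((tatePairingPoint (AinfTop.curveFO (v.adicCompletion K) (Wm.map ψm)) (v.adicCompletion K) p e hμ hadd₁ hadd₂ hgal hcompat
              (oneCocycleClass _ η) P : ℤ_[p]) : ℚ_[p]) =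
            -Algebra.trace ℚ_[p] (v.adicCompletion K) (cP * (expStarCoord (AinfTop.curveFO (v.adicCompletion K) (Wm.map ψm)) hpv d η * c)) := by
  -- the transported period maps at index `N` (edix-p4 g26)
  obtain ⟨LT, P₀, Q₀, hLT, hP₀, hQ₀, hP₀Z, hQ₀Z, hP₀g, hQ₀g⟩ :=
    exists_transported_periodHoms Dv Wm E₀ hWE ψm hψm (hθ := surjective_fontaineTheta_integerC hpv) hN
  haveI := isDomain_bDeRhamPlus (F := v.adicCompletion K) (p := p) (surjective_fontaineTheta_integerC hpv)
  haveI : IsDomain (BdRPlusTop (v.adicCompletion K) p) := isDomain_bDeRhamPlus (F := v.adicCompletion K) (p := p)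
    (surjective_fontaineTheta_integerC hpv)
  -- LEAD g28's one-call package: Hodge-line scalars with their analytic bound, `Fil¹`, and `hne` from (N1′)
  obtain ⟨a, b, dHL, c, hHLsum, -, hneΩ⟩ := TransportedHodgePairHneOmega.exists_hodgePair_fil_and_hne Dv
    (hθ := surjective_fontaineTheta_integerC hpv) Wm E₀ hWE ψm hψm hp2 hN hLT hP₀ hQ₀
  -- the scalars `A = Σ aᵢϖⁱ`, `B = Σ bᵢϖⁱ` of `F`
  obtain ⟨A, hA'⟩ : ∃ A' : v.adicCompletion K,
      A' = ∑ i : Fin Dv.e, algebraMap (PadicBase (v.adicCompletion K) p hpv) (v.adicCompletion K) (a i) * Dv.root ^ (i : ℕ) := ⟨_, rfl⟩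
  obtain ⟨B, hB'⟩ : ∃ B' : v.adicCompletion K,
      B' = ∑ i : Fin Dv.e, algebraMap (PadicBase (v.adicCompletion K) p hpv) (v.adicCompletion K) (b i) * Dv.root ^ (i : ℕ) := ⟨_, rfl⟩
  have hAC : algebraMap (v.adicCompletion K) (CompletedAlgClosure (v.adicCompletion K)) A =
      ∑ i : Fin Dv.e, algebraMap (v.adicCompletion K) (CompletedAlgClosure (v.adicCompletion K))
        (algebraMap (PadicBase (v.adicCompletion K) p hpv) (v.adicCompletion K) (a i)) *
          ((Dv.rootC : integerC (v.adicCompletion K)) : CompletedAlgClosure (v.adicCompletion K)) ^ (i : ℕ) := by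
    rw [hA', map_sum]
    refine Finset.sum_congr rfl fun i _ => ?_
    rw [map_mul, map_pow, EisensteinRoot.coe_rootC]
  have hBC : algebraMap (v.adicCompletion K) (CompletedAlgClosure (v.adicCompletion K)) B =
      ∑ i : Fin Dv.e, algebraMap (v.adicCompletion K) (CompletedAlgClosure (v.adicCompletion K))
        (algebraMap (PadicBase (v.adicCompletion K) p hpv) (v.adicCompletion K) (b i)) *
          ((Dv.rootC : integerC (v.adicCompletion K)) : CompletedAlgClosure (v.adicCompletion K)) ^ (i : ℕ) := by
    rw [hB', map_sum]
    refine Finset.sum_congr rfl fun i _ => ?_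
    rw [map_mul, map_pow, EisensteinRoot.coe_rootC]
  -- the Hodge line in the shape of T2c
  have hHL : ∀ n : ℕ, ‖(p : CompletedAlgClosure (v.adicCompletion K)) ^ dHL * PowerSeries.coeff n
      ((Wm.map ((CBall (v.adicCompletion K)).subtype.comp (EisensteinRoot.CoeffDisc.toCBall Dv))).formalLog -
        PowerSeries.C (algebraMap (v.adicCompletion K) (CompletedAlgClosure (v.adicCompletion K)) A) *
          (E₀.map (Int.castRingHom (CompletedAlgClosure (v.adicCompletion K)))).formalLog -
        PowerSeries.C (algebraMap (v.adicCompletion K) (CompletedAlgClosure (v.adicCompletion K)) B) *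
          PowerSeries.expand p hprime.out.ne_zero (E₀.map (Int.castRingHom (CompletedAlgClosure (v.adicCompletion K)))).formalLog)‖ ≤ 1 := by
    rw [hAC, hBC]; exact hHLsum
  -- `hne` (both branches) at the (N1′)-witness, after cancelling the unit `ι(p^c)`; `(A, B) ≠ 0` from it
  obtain ⟨τ₁, hτ₁⟩ := hN1'
  have hne₁ : BdRPlusTop.of (v.adicCompletion K) p (embBdRHom hpv (surjective_fontaineTheta_integerC hpv) A) * P₀ τ₁ +
      BdRPlusTop.of (v.adicCompletion K) p (embBdRHom hpv (surjective_fontaineTheta_integerC hpv) B) * Q₀ τ₁ ≠ 0 := by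
    have h := hneΩ τ₁ hτ₁
    rw [← hA', ← hB', map_mul, map_mul, map_mul, map_mul, mul_assoc, mul_assoc, ← mul_add] at h
    exact right_ne_zero_of_mul h
  have hAB : A ≠ 0 ∨ B ≠ 0 :=
    TransportedHodgePairHneOmega.ne_zero_or_ne_zero_of_pair_ne_zero (surjective_fontaineTheta_integerC hpv) hne₁
  -- T5-B (this seat), applied STEPWISE (a one-shot application of this many-binder theorem is prohibitively slow to elaborate)
  have h1 := exists_const_tatePairingPoint_eq_neg_trace_transported_formalPoint v hpv Dv Wm ψm hψm hp2 hΔ hA e hμ hadd₁ hadd₂ hgal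
    hcompat hp5 E₀ hWE hΔ₀ hA₀ (N := N) hN (LT := LT) (P₀ := P₀) (Q₀ := Q₀)
  have h2 := h1 hLT
  have h3 := h2 hP₀ hQ₀ hP₀Z hQ₀Z hP₀g hQ₀g A B dHL
  have h4 := h3 hHL hAB (fun _ => ⟨τ₁, hne₁⟩) ψ hψ hψlog
  have h5 := h4 heL healt henondeg
  exact h5 hinj hde d

end Summit.BirchSwinnertonDyer.BirchSwinnertonDyer.Theorems.TransportedReciprocity

end
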